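import Literature.NumberTheory.Sieve.SelbergSieveDualBound
import Literature.NumberTheory.Sieve.Maynard2016Prop94YBound
import Literature.NumberTheory.Sieve.FGKMT2018Prop91Assembly
import HarnessLib

/-!
# Maynard's Proposition 9.4: the bound for `y⁺_{(r, r₀)}` with Maynard's weights

Source: J. Maynard, *Dense clusters of primes in subsets*, Compositio Math. 152 (2016) =
arXiv:1405.2593 [Maynard2016DenseClusters], proof of Proposition 9.4 pp. 25–26
(«`y_{r,r₀} ≪ y_r ỹ_{r₀}`»).

The generic bound `SelbergSieveDualBound.abs_dualY_lamProd_le` specialised to the box `𝒟_k(𝓛)`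
(`= gBox (⌊R⌋,…) (idxMod 𝓛 B R)`, `Maynard2016Prop94YBound.dkBox_eq_gBox`) and Maynard's
`Y_g = y_g/φ_ω(g)`.  The new primes of any `g ∈ 𝒟_k(𝓛)` are `> 2k²`
(`two_mul_sq_lt_of_mem_primeFactors_prod`), so the hypothesis `hY` holds with `A = Y_r` and
`a(p) = 𝟙[2k² < p] (p-k)^{-1}` (`abs_Y_le_of_dvd'`; with this guard the impossible primes `p ∣ WB`
contribute the factor `1`).  Results:
* **`abs_yPlus_le`** —
  `|y⁺(r, r₀)| ≤ Y_r φ(r₀)^{-1} ∏_{p ∣ ∏ r}(1 + 2/(p-1)) ∏_{p ≤ ⌊R⌋ prime, p ∤ ∏ r}(1 + k · 2a(p) c(p))`,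
  `c(p) = 1` if `p ∣ r₀`, else `2/(p-1)`;
* **`abs_yPlus_le_explicit`** — the last product is `≤ 4¹² ∏_{p ∣ r₀}(1 + 4k/p)`
  (`∑_{p > 2k²} 8k²/p² ≤ 12 log 4`, `FGKMT2018.sum_ite_div_sq_le`), i.e.
  `|y⁺(r, r₀)| ≤ 4¹² · Y_r · ∏_{p ∣ ∏ r}(1 + 2/(p-1)) · φ(r₀)^{-1} ∏_{p ∣ r₀}(1 + 4k/p)`.

## References
* J. Maynard, *Dense clusters of primes in subsets*, Compositio Math. 152 (2016), proof of Prop. 9.4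
  pp. 25–26 [Maynard2016DenseClusters].
-/

noncomputable section

open Finset
open scoped ArithmeticFunction.Moebius

namespace Literature.NumberTheory.Sieve.FGKMT2018

variable {k : ℕ}

/-- The primes of `∏ g` for `g ∈ 𝒟_k(𝓛)` are `> 2k²` (they do not divide `WB`).
[cite: Maynard2016DenseClusters, §7 p. 13 (support of λ: (d, WB) = 1, W = ∏_{p ≤ 2k²} p)] -/
theorem two_mul_sq_lt_of_mem_primeFactors_prod {L : Fin k → ℤ × ℤ} {B : ℕ} {R : ℝ}
    {g : Fin k → ℕ} (hg : g ∈ dkBox L B R) {p : ℕ} (hp : p ∈ (∏ i, g i).primeFactors) :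
    2 * k ^ 2 < p := by
  have hpP : p.Prime := Nat.prime_of_mem_primeFactors hp
  refine two_mul_sq_lt_of_not_dvd_wCut_mul (k := k) (B := B) hpP fun h => ?_
  exact (Nat.Prime.coprime_iff_not_dvd hpP).1
    (Nat.Coprime.coprime_dvd_left (Nat.dvd_of_mem_primeFactors hp) (coprime_of_mem_dkBox hg)) h

/-- **`|Y_g| ≤ Y_r ∏_{p ∣ g, p ∤ r} 𝟙[2k² < p](p - k)^{-1}`** — `abs_Y_le_of_dvd` with the sharper guard
`2k² < p` (the new primes are `> 2k²`). [cite: Maynard2016DenseClusters, proof of Prop. 9.4 p. 26; §7 p. 13] -/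
theorem abs_Y_le_of_dvd' (hk : 2 ≤ k) {L : Fin k → ℤ × ℤ} (hadm : FormsAdmissible L) {B : ℕ}
    {R : ℝ} (hR : 1 ≤ R)
    (hpref : 0 ≤ ((wCut k B * B : ℕ) : ℝ) ^ k / (Nat.totient (wCut k B * B) : ℝ) ^ k *
      singSeriesExcl L (wCut k B * B))
    {r g : Fin k → ℕ} (hg : g ∈ dkBox L B R) (hrg : ∀ i, r i ∣ g i) :
    |yVar L B R (MaynardDense.F k) g / phiOmega L (∏ i, g i)| ≤
      yVar L B R (MaynardDense.F k) r / phiOmega L (∏ i, r i) *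
        ∏ p ∈ (∏ i, g i).primeFactors \ (∏ i, r i).primeFactors,
          (if 2 * k ^ 2 < p then (((p : ℝ) - k))⁻¹ else 0) := by
  refine (abs_Y_le_of_dvd hk hadm hR hpref hg hrg).trans_eq ?_
  congr 1
  refine Finset.prod_congr rfl fun p hp => ?_
  have h2 := two_mul_sq_lt_of_mem_primeFactors_prod hg (Finset.mem_sdiff.1 hp).1
  have h1 : k < p := by
    have := Nat.le_self_pow two_ne_zero k
    omega
  rw [if_pos h1, if_pos h2]

/-- **Maynard's `y⁺` is controlled by `y`**: for `r⁺ = (r, r₀)` in the `(k+1)`-dimensional box built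
on `𝒟_k(𝓛)` (levels `⌊R⌋`, moduli `idxMod`; new coordinate of level `R₀` and modulus `M`),
`|y⁺(r⁺)| ≤ (y_r/φ_ω(r)) φ(r₀)^{-1} ∏_{p ∣ ∏ r}(1 + 2/(p-1)) ∏_{p ≤ ⌊R⌋ prime, p ∤ ∏ r}(1 + k·2a(p)c(p))`
with `a(p) = 𝟙[2k² < p](p-k)^{-1}`, `c(p) = 1` if `p ∣ r₀` and `2/(p-1)` otherwise.
[cite: Maynard2016DenseClusters, proof of Prop. 9.4 p. 26 («y_{r,r₀} ≪ y_r ỹ_{r₀}»)] -/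
theorem abs_yPlus_le (hk : 2 ≤ k) {L : Fin k → ℤ × ℤ} (hadm : FormsAdmissible L) {B : ℕ} {R : ℝ}
    (hR : 1 ≤ R)
    (hpref : 0 ≤ ((wCut k B * B : ℕ) : ℝ) ^ k / (Nat.totient (wCut k B * B) : ℝ) ^ k *
      singSeriesExcl L (wCut k B * B))
    {M : ℕ} {R₀ : ℝ} {r : Option (Fin k) → ℕ}
    (hr : r ∈ SelbergBox.gBox (SelbergBox.optN (fun _ : Fin k => ⌊R⌋₊) R₀)
      (SelbergBox.optW (idxMod L B R) M)) :
    |SelbergBox.dualY (SelbergBox.optN (fun _ : Fin k => ⌊R⌋₊) R₀) (SelbergBox.optW (idxMod L B R) M)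
        (SelbergBox.lamProd (fun _ : Fin k => ⌊R⌋₊) (idxMod L B R)
          (fun g => yVar L B R (MaynardDense.F k) g / phiOmega L (∏ i, g i)) M R₀) r| ≤
      (yVar L B R (MaynardDense.F k) (fun i => r (some i)) / phiOmega L (∏ i, r (some i))) *
        ((Nat.totient (r none) : ℕ) : ℝ)⁻¹ *
        (∏ p ∈ (∏ j, r (some j)).primeFactors, (1 + 2 / ((p : ℝ) - 1))) *
        ∏ p ∈ ((Finset.range (⌊R⌋₊ + 1)).filter Nat.Prime) \ (∏ j, r (some j)).primeFactors,
          (1 + k * (2 * (if 2 * k ^ 2 < p then (((p : ℝ) - k))⁻¹ else 0) *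
            (if p ∈ (r none).primeFactors then 1 else 2 / ((p : ℝ) - 1)))) := by
  obtain ⟨hr₁, -, -⟩ := SelbergBox.mem_gBox_opt.1 hr
  have hr₁' : (fun i => r (some i)) ∈ dkBox L B R := by rw [dkBox_eq_gBox]; exact hr₁
  have hr1 : ∀ i, 1 ≤ r (some i) := one_le_of_mem_dkBox hr₁'
  have hA : 0 ≤ yVar L B R (MaynardDense.F k) (fun i => r (some i)) /
      phiOmega L (∏ i, r (some i)) :=
    div_nonneg (yVar_F_nonneg hk L B hR hpref hr1) (phiOmega_prod_pos_of_mem_dkBox hadm hr₁').le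
  have ha : ∀ p : ℕ, 0 ≤ (if 2 * k ^ 2 < p then (((p : ℝ) - k))⁻¹ else 0) := by
    intro p
    split_ifs with h
    · have h1 : k < p := by
        have := Nat.le_self_pow two_ne_zero k
        omega
      have : (k : ℝ) < p := by exact_mod_cast h1
      exact inv_nonneg.2 (by linarith)
    · exact le_rfl
  have hY : ∀ g ∈ SelbergBox.gBox (fun _ : Fin k => ⌊R⌋₊) (idxMod L B R),
      (∀ i, r (some i) ∣ g i) →
      |yVar L B R (MaynardDense.F k) g / phiOmega L (∏ i, g i)| ≤
        yVar L B R (MaynardDense.F k) (fun i => r (some i)) / phiOmega L (∏ i, r (some i)) *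
          ∏ p ∈ (∏ j, g j).primeFactors \ (∏ j, r (some j)).primeFactors,
            (if 2 * k ^ 2 < p then (((p : ℝ) - k))⁻¹ else 0) := by
    intro g hg hrg
    have hg' : g ∈ dkBox L B R := by rw [dkBox_eq_gBox]; exact hg
    exact abs_Y_le_of_dvd' hk hadm hR hpref hg' hrg
  have h := SelbergBox.abs_dualY_lamProd_le (M := M) (R₀ := R₀) hr hA ha hY
    (T := ⌊R⌋₊) (fun _ => le_rfl)
  simpa only [Fintype.card_fin] using h

/-- Per-prime estimate for the primes `p ∣ r₀`: `1 + k · 2a(p) ≤ 1 + 4k/p` (`a(p) = 𝟙[2k²<p](p-k)^{-1}`,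
`p - k ≥ p/2`). [cite: Maynard2016DenseClusters, proof of Prop. 9.4 p. 26] -/
theorem one_add_mul_ite_le (hk : 2 ≤ k) (p : ℕ) (hp : p.Prime) :
    1 + (k : ℝ) * (2 * (if 2 * k ^ 2 < p then (((p : ℝ) - k))⁻¹ else 0) * 1) ≤
      1 + 4 * (k : ℝ) / p := by
  have hp0 : (0 : ℝ) < p := by exact_mod_cast hp.pos
  have hk0 : (0 : ℝ) ≤ k := by positivity
  split_ifs with h
  · have h2 : (2 : ℝ) * (k : ℝ) ^ 2 < p := by exact_mod_cast h
    have hk2 : (2 : ℝ) ≤ k := by exact_mod_cast hk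
    have hpk : (p : ℝ) / 2 ≤ (p : ℝ) - k := by nlinarith
    have hpk0 : 0 < (p : ℝ) - k := by linarith
    have hinv : ((p : ℝ) - k)⁻¹ ≤ 2 / p := by
      rw [inv_eq_one_div, div_le_div_iff₀ hpk0 hp0]
      linarith
    have : (k : ℝ) * (2 * ((p : ℝ) - k)⁻¹ * 1) ≤ 4 * (k : ℝ) / p := by
      calc (k : ℝ) * (2 * ((p : ℝ) - k)⁻¹ * 1) = 2 * k * ((p : ℝ) - k)⁻¹ := by ring
        _ ≤ 2 * k * (2 / p) := mul_le_mul_of_nonneg_left hinv (by positivity)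
        _ = 4 * (k : ℝ) / p := by ring
    linarith
  · simp only [mul_zero, zero_mul, add_zero]
    have : (0 : ℝ) ≤ 4 * (k : ℝ) / p := by positivity
    linarith

/-- Per-prime estimate for the primes `p ∤ r₀`: `k · 2a(p) · 2/(p-1) ≤ 𝟙[2k²<p] 8k²/p²` (`k ≥ 2`).
[cite: Maynard2016DenseClusters, proof of Prop. 9.4 p. 26; proof of Prop. 9.1 p. 20] -/
theorem mul_ite_mul_div_le (hk : 2 ≤ k) (p : ℕ) (hp : p.Prime) :
    (k : ℝ) * (2 * (if 2 * k ^ 2 < p then (((p : ℝ) - k))⁻¹ else 0) * (2 / ((p : ℝ) - 1))) ≤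
      (if 2 * k ^ 2 < p then 8 * (k : ℝ) ^ 2 / (p : ℝ) ^ 2 else 0) := by
  have hp0 : (0 : ℝ) < p := by exact_mod_cast hp.pos
  split_ifs with h
  · have h2 : (2 : ℝ) * (k : ℝ) ^ 2 < p := by exact_mod_cast h
    have hk2 : (2 : ℝ) ≤ k := by exact_mod_cast hk
    have hpk : (p : ℝ) / 2 ≤ (p : ℝ) - k := by nlinarith
    have hp1 : (p : ℝ) / 2 ≤ (p : ℝ) - 1 := by nlinarith
    have hpk0 : 0 < (p : ℝ) - k := by linarith
    have hp10 : 0 < (p : ℝ) - 1 := by linarith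
    have hprod : (p : ℝ) ^ 2 / 4 ≤ ((p : ℝ) - k) * ((p : ℝ) - 1) := by
      have := mul_le_mul hpk hp1 (by positivity) hpk0.le
      nlinarith
    have hlhs : (k : ℝ) * (2 * ((p : ℝ) - k)⁻¹ * (2 / ((p : ℝ) - 1))) =
        4 * k / (((p : ℝ) - k) * ((p : ℝ) - 1)) := by
      field_simp
      ring
    rw [hlhs, div_le_div_iff₀ (by positivity) (by positivity)]
    have hA : 8 * (k : ℝ) ^ 2 * ((p : ℝ) ^ 2 / 4) ≤ 8 * (k : ℝ) ^ 2 * (((p : ℝ) - k) * ((p : ℝ) - 1)) :=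
      mul_le_mul_of_nonneg_left hprod (by positivity)
    have hB : 0 ≤ 2 * (k : ℝ) * (p : ℝ) ^ 2 * ((k : ℝ) - 2) :=
      mul_nonneg (by positivity) (sub_nonneg.2 hk2)
    nlinarith [hA, hB]
  · simp only [mul_zero, zero_mul]
    exact le_rfl

/-- **The coupling product is `O(1) · ∏_{p ∣ r₀}(1 + 4k/p)`**: for any finite set `P` of primes below
`y` and any `r₀`, `∏_{p ∈ P}(1 + k·2a(p)c(p)) ≤ 4¹² ∏_{p ∣ r₀}(1 + 4k/p)` where `c(p) = 1` if `p ∣ r₀`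
and `2/(p-1)` otherwise (`∏_{p ∤ r₀} ≤ exp(∑_{p > 2k²} 8k²/p²) ≤ 4¹²`).
[cite: Maynard2016DenseClusters, proof of Prop. 9.4 p. 26 («the first product is O(1)»)] -/
theorem prod_coupling_le (hk : 2 ≤ k) {P : Finset ℕ} {y : ℕ} (hP : P ⊆ Nat.primesBelow y)
    (r₀ : ℕ) :
    ∏ p ∈ P, (1 + k * (2 * (if 2 * k ^ 2 < p then (((p : ℝ) - k))⁻¹ else 0) *
        (if p ∈ r₀.primeFactors then 1 else 2 / ((p : ℝ) - 1)))) ≤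
      (4 : ℝ) ^ 12 * ∏ p ∈ r₀.primeFactors, (1 + 4 * (k : ℝ) / p) := by
  classical
  have hPp : ∀ p ∈ P, p.Prime := fun p hp => (Nat.mem_primesBelow.1 (hP hp)).2
  have ha : ∀ p : ℕ, 0 ≤ (if 2 * k ^ 2 < p then (((p : ℝ) - k))⁻¹ else 0) := by
    intro p
    split_ifs with h
    · have h1 : k < p := by
        have := Nat.le_self_pow two_ne_zero k
        omega
      have : (k : ℝ) < p := by exact_mod_cast h1
      exact inv_nonneg.2 (by linarith)
    · exact le_rfl
  set f : ℕ → ℝ := fun p => 1 + k * (2 * (if 2 * k ^ 2 < p then (((p : ℝ) - k))⁻¹ else 0) *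
    (if p ∈ r₀.primeFactors then 1 else 2 / ((p : ℝ) - 1))) with hf
  have hf0 : ∀ p ∈ P, 0 ≤ f p - 1 := by
    intro p hp
    have hpge : (2 : ℝ) ≤ p := by exact_mod_cast (hPp p hp).two_le
    have h3 : (0 : ℝ) ≤ (if p ∈ r₀.primeFactors then (1 : ℝ) else 2 / ((p : ℝ) - 1)) := by
      split_ifs
      · exact zero_le_one
      · exact div_nonneg (by norm_num) (by linarith)
    have := ha p
    simp only [hf, add_sub_cancel_left]
    positivity
  rw [← Finset.prod_filter_mul_prod_filter_not P (fun p => p ∈ r₀.primeFactors)]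
  -- the primes of `r₀`
  have h1 : ∏ p ∈ P.filter (fun p => p ∈ r₀.primeFactors), f p ≤
      ∏ p ∈ r₀.primeFactors, (1 + 4 * (k : ℝ) / p) := by
    calc ∏ p ∈ P.filter (fun p => p ∈ r₀.primeFactors), f p
        ≤ ∏ p ∈ P.filter (fun p => p ∈ r₀.primeFactors), (1 + 4 * (k : ℝ) / p) := by
          refine Finset.prod_le_prod (fun p hp => ?_) fun p hp => ?_
          · linarith [hf0 p (Finset.mem_filter.1 hp).1]
          · obtain ⟨hp1, hp2⟩ := Finset.mem_filter.1 hp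
            simp only [hf, if_pos hp2]
            exact one_add_mul_ite_le hk p (hPp p hp1)
      _ ≤ ∏ p ∈ r₀.primeFactors, (1 + 4 * (k : ℝ) / p) := by
          have hsub : P.filter (fun p => p ∈ r₀.primeFactors) ⊆ r₀.primeFactors :=
            fun p hp => (Finset.mem_filter.1 hp).2
          have hge1 : (1 : ℝ) ≤ ∏ p ∈ r₀.primeFactors \ P.filter (fun p => p ∈ r₀.primeFactors),
              (1 + 4 * (k : ℝ) / p) := by
            have := Finset.prod_le_prod (s := r₀.primeFactors \ P.filter (fun p => p ∈ r₀.primeFactors))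
              (f := fun _ => (1 : ℝ)) (g := fun p : ℕ => 1 + 4 * (k : ℝ) / (p : ℝ))
              (fun _ _ => zero_le_one) fun p _ => by
                have : (0 : ℝ) ≤ 4 * (k : ℝ) / (p : ℝ) := by positivity
                show (1 : ℝ) ≤ 1 + 4 * (k : ℝ) / (p : ℝ)
                linarith
            simpa using this
          have hn : 0 ≤ ∏ p ∈ P.filter (fun p => p ∈ r₀.primeFactors), (1 + 4 * (k : ℝ) / p) :=
            Finset.prod_nonneg fun p _ => by positivity
          calc ∏ p ∈ P.filter (fun p => p ∈ r₀.primeFactors), (1 + 4 * (k : ℝ) / p)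
              = (∏ p ∈ P.filter (fun p => p ∈ r₀.primeFactors), (1 + 4 * (k : ℝ) / p)) * 1 :=
                (mul_one _).symm
            _ ≤ (∏ p ∈ P.filter (fun p => p ∈ r₀.primeFactors), (1 + 4 * (k : ℝ) / p)) *
                  ∏ p ∈ r₀.primeFactors \ P.filter (fun p => p ∈ r₀.primeFactors),
                    (1 + 4 * (k : ℝ) / p) := mul_le_mul_of_nonneg_left hge1 hn
            _ = ∏ p ∈ r₀.primeFactors, (1 + 4 * (k : ℝ) / p) := by
                rw [mul_comm, Finset.prod_sdiff hsub]
  -- the other primes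
  have h2 : ∏ p ∈ P.filter (fun p => ¬ p ∈ r₀.primeFactors), f p ≤ (4 : ℝ) ^ 12 := by
    have hterm : ∀ p ∈ P.filter (fun p => ¬ p ∈ r₀.primeFactors),
        f p - 1 ≤ (if 2 * k ^ 2 < p then 8 * (k : ℝ) ^ 2 / (p : ℝ) ^ 2 else 0) := by
      intro p hp
      obtain ⟨hp1, hp2⟩ := Finset.mem_filter.1 hp
      simp only [hf, if_neg hp2, add_sub_cancel_left]
      exact mul_ite_mul_div_le hk p (hPp p hp1)
    calc ∏ p ∈ P.filter (fun p => ¬ p ∈ r₀.primeFactors), f p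
        = ∏ p ∈ P.filter (fun p => ¬ p ∈ r₀.primeFactors), (1 + (f p - 1)) := by
          simp only [add_sub_cancel]
      _ ≤ Real.exp (∑ p ∈ P.filter (fun p => ¬ p ∈ r₀.primeFactors), (f p - 1)) := by
          rw [Real.exp_sum]
          refine Finset.prod_le_prod (fun p hp => by linarith [hf0 p (Finset.mem_filter.1 hp).1])
            fun p _ => ?_
          linarith [Real.add_one_le_exp (f p - 1)]
      _ ≤ Real.exp (∑ p ∈ Nat.primesBelow y,
            (if 2 * k ^ 2 < p then 8 * (k : ℝ) ^ 2 / (p : ℝ) ^ 2 else 0)) := by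
          refine Real.exp_le_exp.2 ((Finset.sum_le_sum hterm).trans ?_)
          refine Finset.sum_le_sum_of_subset_of_nonneg
            (fun p hp => hP (Finset.mem_filter.1 hp).1) fun p _ _ => ?_
          split_ifs
          · positivity
          · exact le_rfl
      _ ≤ Real.exp (12 * Real.log 4) := Real.exp_le_exp.2 (sum_ite_div_sq_le hk y)
      _ = (4 : ℝ) ^ 12 := by
          rw [show (12 : ℝ) * Real.log 4 = Real.log ((4 : ℝ) ^ 12) by
            rw [Real.log_pow]; norm_num, Real.exp_log (by positivity)]
  have h2n : 0 ≤ ∏ p ∈ P.filter (fun p => ¬ p ∈ r₀.primeFactors), f p :=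
    Finset.prod_nonneg fun p hp => by linarith [hf0 p (Finset.mem_filter.1 hp).1]
  calc (∏ p ∈ P.filter (fun p => p ∈ r₀.primeFactors), f p) *
        ∏ p ∈ P.filter (fun p => ¬ p ∈ r₀.primeFactors), f p
      ≤ (∏ p ∈ r₀.primeFactors, (1 + 4 * (k : ℝ) / p)) * (4 : ℝ) ^ 12 :=
        mul_le_mul h1 h2 h2n (Finset.prod_nonneg fun p _ => by positivity)
    _ = (4 : ℝ) ^ 12 * ∏ p ∈ r₀.primeFactors, (1 + 4 * (k : ℝ) / p) := mul_comm _ _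

/-- **`|y⁺(r, r₀)| ≤ 4¹² · Y_r · ∏_{p ∣ ∏ r}(1 + 2/(p-1)) · φ(r₀)^{-1} ∏_{p ∣ r₀}(1 + 4k/p)`** — Maynard's
«`y_{r,r₀} ≪ y_r ỹ_{r₀}`» for the weights on `ℤ` (P94-SPEC §1d′), all constants absolute.
[cite: Maynard2016DenseClusters, proof of Prop. 9.4 p. 26] -/
theorem abs_yPlus_le_explicit (hk : 2 ≤ k) {L : Fin k → ℤ × ℤ} (hadm : FormsAdmissible L) {B : ℕ}
    {R : ℝ} (hR : 1 ≤ R)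
    (hpref : 0 ≤ ((wCut k B * B : ℕ) : ℝ) ^ k / (Nat.totient (wCut k B * B) : ℝ) ^ k *
      singSeriesExcl L (wCut k B * B))
    {M : ℕ} {R₀ : ℝ} {r : Option (Fin k) → ℕ}
    (hr : r ∈ SelbergBox.gBox (SelbergBox.optN (fun _ : Fin k => ⌊R⌋₊) R₀)
      (SelbergBox.optW (idxMod L B R) M)) :
    |SelbergBox.dualY (SelbergBox.optN (fun _ : Fin k => ⌊R⌋₊) R₀) (SelbergBox.optW (idxMod L B R) M)
        (SelbergBox.lamProd (fun _ : Fin k => ⌊R⌋₊) (idxMod L B R)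
          (fun g => yVar L B R (MaynardDense.F k) g / phiOmega L (∏ i, g i)) M R₀) r| ≤
      (4 : ℝ) ^ 12 *
        (yVar L B R (MaynardDense.F k) (fun i => r (some i)) / phiOmega L (∏ i, r (some i))) *
        (∏ p ∈ (∏ j, r (some j)).primeFactors, (1 + 2 / ((p : ℝ) - 1))) *
        (((Nat.totient (r none) : ℕ) : ℝ)⁻¹ * ∏ p ∈ (r none).primeFactors, (1 + 4 * (k : ℝ) / p)) := by
  have h := abs_yPlus_le hk hadm hR hpref hr
  obtain ⟨hr₁, -, -⟩ := SelbergBox.mem_gBox_opt.1 hr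
  have hr₁' : (fun i => r (some i)) ∈ dkBox L B R := by rw [dkBox_eq_gBox]; exact hr₁
  have hA : 0 ≤ yVar L B R (MaynardDense.F k) (fun i => r (some i)) /
      phiOmega L (∏ i, r (some i)) :=
    div_nonneg (yVar_F_nonneg hk L B hR hpref (one_le_of_mem_dkBox hr₁'))
      (phiOmega_prod_pos_of_mem_dkBox hadm hr₁').le
  have hE : 0 ≤ ∏ p ∈ (∏ j, r (some j)).primeFactors, (1 + 2 / ((p : ℝ) - 1)) :=
    Finset.prod_nonneg fun p hp => by
      have : (2 : ℝ) ≤ p := by exact_mod_cast (Nat.prime_of_mem_primeFactors hp).two_le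
      have : (0 : ℝ) ≤ 2 / ((p : ℝ) - 1) := div_nonneg (by norm_num) (by linarith)
      linarith
  have hφ : 0 ≤ ((Nat.totient (r none) : ℕ) : ℝ)⁻¹ := by positivity
  have hP : ((Finset.range (⌊R⌋₊ + 1)).filter Nat.Prime) \ (∏ j, r (some j)).primeFactors ⊆
      Nat.primesBelow (⌊R⌋₊ + 1) := fun p hp => (Finset.mem_sdiff.1 hp).1
  have hG := prod_coupling_le hk hP (r none)
  refine h.trans ?_
  calc _ ≤ (yVar L B R (MaynardDense.F k) (fun i => r (some i)) / phiOmega L (∏ i, r (some i))) *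
        ((Nat.totient (r none) : ℕ) : ℝ)⁻¹ *
        (∏ p ∈ (∏ j, r (some j)).primeFactors, (1 + 2 / ((p : ℝ) - 1))) *
        ((4 : ℝ) ^ 12 * ∏ p ∈ (r none).primeFactors, (1 + 4 * (k : ℝ) / p)) :=
        mul_le_mul_of_nonneg_left hG (mul_nonneg (mul_nonneg hA hφ) hE)
    _ = _ := by ring

/-! ### The diagonal sum of the `(k+1)`-dimensional quadratic form splits -/

/-- The local weight `p + 4(k+1) - 1 = p + 4k + 3` is positive. [cite: Maynard2016DenseClusters, proof of Prop. 9.4 p. 26 («p + O(k)»)] -/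
private theorem wt_pos (p : ℕ) (k : ℕ) : (0 : ℝ) < (p : ℝ) + 4 * ((k : ℝ) + 1) - 1 := by
  have h1 : (0 : ℝ) ≤ p := Nat.cast_nonneg p
  have h2 : (0 : ℝ) ≤ k := Nat.cast_nonneg k
  linarith

/-- **Squared form with the local weights of `SelbergSieveGBoxBounds.abs_quadForm_le`** (`|ι| = k+1`):
for `r⁺ = (r, r₀)` in the coupled box,
`y⁺(r⁺)² ∏_{p ∣ ∏ r⁺}(p + 4(k+1) - 1) ≤ 4²⁴ (Y_r² E(r)² ∏_{p ∣ ∏ r}(…)) (φ(r₀)^{-2} H(r₀)² ∏_{p ∣ r₀}(…))`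
with `E(r) = ∏_{p ∣ ∏ r}(1 + 2/(p-1))`, `H(r₀) = ∏_{p ∣ r₀}(1 + 4k/p)`.
[cite: Maynard2016DenseClusters, proof of Prop. 9.4 p. 26 (display «∑_{r,r₀} y²_{r,r₀}/∏(p+O(k)) ≪ (∑_{r₀} …)(∑_r …)»)] -/
theorem sq_yPlus_mul_prod_le (hk : 2 ≤ k) {L : Fin k → ℤ × ℤ} (hadm : FormsAdmissible L) {B : ℕ}
    {R : ℝ} (hR : 1 ≤ R)
    (hpref : 0 ≤ ((wCut k B * B : ℕ) : ℝ) ^ k / (Nat.totient (wCut k B * B) : ℝ) ^ k *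
      singSeriesExcl L (wCut k B * B))
    {M : ℕ} {R₀ : ℝ} {r : Option (Fin k) → ℕ}
    (hr : r ∈ SelbergBox.gBox (SelbergBox.optN (fun _ : Fin k => ⌊R⌋₊) R₀)
      (SelbergBox.optW (idxMod L B R) M)) :
    SelbergBox.dualY (SelbergBox.optN (fun _ : Fin k => ⌊R⌋₊) R₀) (SelbergBox.optW (idxMod L B R) M)
        (SelbergBox.lamProd (fun _ : Fin k => ⌊R⌋₊) (idxMod L B R)
          (fun g => yVar L B R (MaynardDense.F k) g / phiOmega L (∏ i, g i)) M R₀) r ^ 2 *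
      ∏ p ∈ (∏ o, r o).primeFactors, ((p : ℝ) + 4 * ((k : ℝ) + 1) - 1) ≤
      (4 : ℝ) ^ 24 *
        ((yVar L B R (MaynardDense.F k) (fun i => r (some i)) / phiOmega L (∏ i, r (some i))) ^ 2 *
          (∏ p ∈ (∏ j, r (some j)).primeFactors, (1 + 2 / ((p : ℝ) - 1))) ^ 2 *
          ∏ p ∈ (∏ j, r (some j)).primeFactors, ((p : ℝ) + 4 * ((k : ℝ) + 1) - 1)) *
        ((((Nat.totient (r none) : ℕ) : ℝ)⁻¹) ^ 2 *
          (∏ p ∈ (r none).primeFactors, (1 + 4 * (k : ℝ) / p)) ^ 2 *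
          ∏ p ∈ (r none).primeFactors, ((p : ℝ) + 4 * ((k : ℝ) + 1) - 1)) := by
  have h := abs_yPlus_le_explicit hk hadm hR hpref hr
  obtain ⟨hr₁, hr₀, hcop⟩ := SelbergBox.mem_gBox_opt.1 hr
  -- the prime factors of `∏ r⁺` split
  have hr₁0 : (∏ i, r (some i)) ≠ 0 := (SelbergBox.squarefree_of_mem_gBox hr₁).ne_zero
  have hr₀0 : r none ≠ 0 := (SelbergBox.mem_box₀.1 hr₀).2.1.ne_zero
  have hsplit : ∏ p ∈ (∏ o, r o).primeFactors, ((p : ℝ) + 4 * ((k : ℝ) + 1) - 1) =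
      (∏ p ∈ (∏ j, r (some j)).primeFactors, ((p : ℝ) + 4 * ((k : ℝ) + 1) - 1)) *
        ∏ p ∈ (r none).primeFactors, ((p : ℝ) + 4 * ((k : ℝ) + 1) - 1) := by
    rw [Fintype.prod_option, Nat.primeFactors_mul hr₀0 hr₁0,
      Finset.prod_union (Nat.Coprime.disjoint_primeFactors hcop.symm), mul_comm]
  have hW : 0 ≤ (∏ p ∈ (∏ j, r (some j)).primeFactors, ((p : ℝ) + 4 * ((k : ℝ) + 1) - 1)) *
      ∏ p ∈ (r none).primeFactors, ((p : ℝ) + 4 * ((k : ℝ) + 1) - 1) :=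
    mul_nonneg (Finset.prod_nonneg fun p _ => (wt_pos p k).le)
      (Finset.prod_nonneg fun p _ => (wt_pos p k).le)
  have hsq : SelbergBox.dualY (SelbergBox.optN (fun _ : Fin k => ⌊R⌋₊) R₀)
        (SelbergBox.optW (idxMod L B R) M)
        (SelbergBox.lamProd (fun _ : Fin k => ⌊R⌋₊) (idxMod L B R)
          (fun g => yVar L B R (MaynardDense.F k) g / phiOmega L (∏ i, g i)) M R₀) r ^ 2 ≤
      ((4 : ℝ) ^ 12 *
        (yVar L B R (MaynardDense.F k) (fun i => r (some i)) / phiOmega L (∏ i, r (some i))) *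
        (∏ p ∈ (∏ j, r (some j)).primeFactors, (1 + 2 / ((p : ℝ) - 1))) *
        (((Nat.totient (r none) : ℕ) : ℝ)⁻¹ *
          ∏ p ∈ (r none).primeFactors, (1 + 4 * (k : ℝ) / p))) ^ 2 := by
    rw [← sq_abs]
    exact pow_le_pow_left₀ (abs_nonneg _) h 2
  rw [hsplit]
  calc _ ≤ ((4 : ℝ) ^ 12 *
        (yVar L B R (MaynardDense.F k) (fun i => r (some i)) / phiOmega L (∏ i, r (some i))) *
        (∏ p ∈ (∏ j, r (some j)).primeFactors, (1 + 2 / ((p : ℝ) - 1))) *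
        (((Nat.totient (r none) : ℕ) : ℝ)⁻¹ *
          ∏ p ∈ (r none).primeFactors, (1 + 4 * (k : ℝ) / p))) ^ 2 *
        ((∏ p ∈ (∏ j, r (some j)).primeFactors, ((p : ℝ) + 4 * ((k : ℝ) + 1) - 1)) *
          ∏ p ∈ (r none).primeFactors, ((p : ℝ) + 4 * ((k : ℝ) + 1) - 1)) :=
        mul_le_mul_of_nonneg_right hsq hW
    _ = _ := by ring

/-- **The diagonal sum splits into a `k`-dimensional and a one-dimensional sum**:
`∑_{r⁺ ∈ box⁺} y⁺(r⁺)² ∏_{p ∣ ∏ r⁺}(p + 4(k+1) - 1)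
   ≤ 4²⁴ (∑_{r ∈ 𝒟_k(𝓛)} Y_r² E(r)² ∏_{p ∣ ∏ r}(…)) (∑_{r₀ ∈ box₀(M,R₀)} φ(r₀)^{-2} H(r₀)² ∏_{p ∣ r₀}(…))`
(the cross-coprimality between `r` and `r₀` is dropped; all terms are `≥ 0`). This is the right-hand
side of `SelbergSieveGBoxBounds.abs_quadForm_le` for the coupled weights `λ⁺ = λ · λ̃`.
[cite: Maynard2016DenseClusters, proof of Prop. 9.4 p. 26 (display after (9.10): «≪ (∑_{r₀<x^ξ} ỹ²/∏(p+O(k)))(∑_{r ∈ 𝒟_k} y_r²/∏(p+O(k)))»)] -/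
theorem sum_sq_yPlus_mul_prod_le (hk : 2 ≤ k) {L : Fin k → ℤ × ℤ} (hadm : FormsAdmissible L)
    {B : ℕ} {R : ℝ} (hR : 1 ≤ R)
    (hpref : 0 ≤ ((wCut k B * B : ℕ) : ℝ) ^ k / (Nat.totient (wCut k B * B) : ℝ) ^ k *
      singSeriesExcl L (wCut k B * B))
    (M : ℕ) (R₀ : ℝ) :
    ∑ r ∈ SelbergBox.gBox (SelbergBox.optN (fun _ : Fin k => ⌊R⌋₊) R₀)
        (SelbergBox.optW (idxMod L B R) M),
      SelbergBox.dualY (SelbergBox.optN (fun _ : Fin k => ⌊R⌋₊) R₀)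
          (SelbergBox.optW (idxMod L B R) M)
          (SelbergBox.lamProd (fun _ : Fin k => ⌊R⌋₊) (idxMod L B R)
            (fun g => yVar L B R (MaynardDense.F k) g / phiOmega L (∏ i, g i)) M R₀) r ^ 2 *
        ∏ p ∈ (∏ o, r o).primeFactors, ((p : ℝ) + 4 * ((k : ℝ) + 1) - 1) ≤
      (4 : ℝ) ^ 24 *
        (∑ g ∈ dkBox L B R,
          (yVar L B R (MaynardDense.F k) g / phiOmega L (∏ i, g i)) ^ 2 *
            (∏ p ∈ (∏ j, g j).primeFactors, (1 + 2 / ((p : ℝ) - 1))) ^ 2 *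
            ∏ p ∈ (∏ j, g j).primeFactors, ((p : ℝ) + 4 * ((k : ℝ) + 1) - 1)) *
        ∑ r₀ ∈ SelbergBox.box₀ M R₀,
          (((Nat.totient r₀ : ℕ) : ℝ)⁻¹) ^ 2 * (∏ p ∈ r₀.primeFactors, (1 + 4 * (k : ℝ) / p)) ^ 2 *
            ∏ p ∈ r₀.primeFactors, ((p : ℝ) + 4 * ((k : ℝ) + 1) - 1) := by
  classical
  set boxP := SelbergBox.gBox (SelbergBox.optN (fun _ : Fin k => ⌊R⌋₊) R₀)
    (SelbergBox.optW (idxMod L B R) M) with hboxP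
  set Φ : (Fin k → ℕ) → ℝ := fun g =>
    (yVar L B R (MaynardDense.F k) g / phiOmega L (∏ i, g i)) ^ 2 *
      (∏ p ∈ (∏ j, g j).primeFactors, (1 + 2 / ((p : ℝ) - 1))) ^ 2 *
      ∏ p ∈ (∏ j, g j).primeFactors, ((p : ℝ) + 4 * ((k : ℝ) + 1) - 1) with hΦ
  set Ψ : ℕ → ℝ := fun r₀ =>
    (((Nat.totient r₀ : ℕ) : ℝ)⁻¹) ^ 2 * (∏ p ∈ r₀.primeFactors, (1 + 4 * (k : ℝ) / p)) ^ 2 *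
      ∏ p ∈ r₀.primeFactors, ((p : ℝ) + 4 * ((k : ℝ) + 1) - 1) with hΨ
  have hΦ0 : ∀ g, 0 ≤ Φ g := fun g =>
    mul_nonneg (mul_nonneg (sq_nonneg _) (sq_nonneg _)) (Finset.prod_nonneg fun p _ => (wt_pos p k).le)
  have hΨ0 : ∀ r₀, 0 ≤ Ψ r₀ := fun r₀ =>
    mul_nonneg (mul_nonneg (sq_nonneg _) (sq_nonneg _)) (Finset.prod_nonneg fun p _ => (wt_pos p k).le)
  -- termwise bound
  have hterm : ∀ r ∈ boxP,
      SelbergBox.dualY (SelbergBox.optN (fun _ : Fin k => ⌊R⌋₊) R₀)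
          (SelbergBox.optW (idxMod L B R) M)
          (SelbergBox.lamProd (fun _ : Fin k => ⌊R⌋₊) (idxMod L B R)
            (fun g => yVar L B R (MaynardDense.F k) g / phiOmega L (∏ i, g i)) M R₀) r ^ 2 *
        ∏ p ∈ (∏ o, r o).primeFactors, ((p : ℝ) + 4 * ((k : ℝ) + 1) - 1) ≤
      (4 : ℝ) ^ 24 * (Φ (fun i => r (some i)) * Ψ (r none)) := by
    intro r hr
    refine (sq_yPlus_mul_prod_le hk hadm hR hpref hr).trans_eq ?_
    simp only [hΦ, hΨ]
    ring
  refine (Finset.sum_le_sum hterm).trans ?_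
  rw [← Finset.mul_sum]
  -- reindex `r⁺ ↦ (r, r₀)` into `𝒟_k × box₀`
  have hmaps : ∀ r ∈ boxP, ((fun i => r (some i)), r none) ∈ dkBox L B R ×ˢ SelbergBox.box₀ M R₀ := by
    intro r hr
    obtain ⟨hr₁, hr₀, -⟩ := SelbergBox.mem_gBox_opt.1 hr
    rw [dkBox_eq_gBox]
    exact Finset.mem_product.2 ⟨hr₁, hr₀⟩
  have hinj : Set.InjOn (fun r : Option (Fin k) → ℕ => ((fun i => r (some i)), r none)) ↑boxP := by
    intro r _ r' _ h
    simp only [Prod.mk.injEq] at h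
    funext o
    cases o with
    | none => exact h.2
    | some i => exact congrFun h.1 i
  have key : ∑ r ∈ boxP, Φ (fun i => r (some i)) * Ψ (r none) ≤
      (∑ g ∈ dkBox L B R, Φ g) * ∑ r₀ ∈ SelbergBox.box₀ M R₀, Ψ r₀ := by
    calc ∑ r ∈ boxP, Φ (fun i => r (some i)) * Ψ (r none)
        = ∑ q ∈ boxP.image (fun r : Option (Fin k) → ℕ => ((fun i => r (some i)), r none)),
            Φ q.1 * Ψ q.2 := by
          rw [Finset.sum_image hinj]
      _ ≤ ∑ q ∈ dkBox L B R ×ˢ SelbergBox.box₀ M R₀, Φ q.1 * Ψ q.2 := by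
          refine Finset.sum_le_sum_of_subset_of_nonneg (fun q hq => ?_)
            fun q _ _ => mul_nonneg (hΦ0 _) (hΨ0 _)
          obtain ⟨r, hr, rfl⟩ := Finset.mem_image.1 hq
          exact hmaps r hr
      _ = (∑ g ∈ dkBox L B R, Φ g) * ∑ r₀ ∈ SelbergBox.box₀ M R₀, Ψ r₀ := by
          rw [Finset.sum_product, Finset.sum_mul_sum]
  calc (4 : ℝ) ^ 24 * ∑ r ∈ boxP, Φ (fun i => r (some i)) * Ψ (r none)
      ≤ (4 : ℝ) ^ 24 * ((∑ g ∈ dkBox L B R, Φ g) * ∑ r₀ ∈ SelbergBox.box₀ M R₀, Ψ r₀) :=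
        mul_le_mul_of_nonneg_left key (by positivity)
    _ = _ := by ring

end Literature.NumberTheory.Sieve.FGKMT2018
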